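import Literature.NumberTheory.LFunctions.WeilMarkovQuadratic
import Literature.NumberTheory.LFunctions.WeilGroundState
import Literature.NumberTheory.LFunctions.WeilGroundStateRealZerosProofs
import Literature.NumberTheory.LFunctions.WeilWindowSuzukiProofs
import Literature.NumberTheory.LFunctions.WeilWindowSuzukiAsymptoticProofs
import Literature.NumberTheory.LFunctions.WeilSemilocalCompactnessProofs
import Summits.RiemannHypothesis.RiemannHypothesis.Theorems.WeilWindowFlowWindowLipschitzStubSupBoundAux

/-!
# Markov part of Weil's form: lower semicontinuity and existence of a minimiser

Support file for item `MarkovPartPositiveGroundState` of route `WeilGroundState`. The pole-removed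
form `Q₀(g) = Re Q(g) − P(g)` (`weilMarkovQuadratic`) is `𝓔_a(g) − M_a ‖g‖₂²` on the window
`[-a, a]` (`weilMarkovQuadratic_eq_weilDirichletEnergy_sub`). With

  `S_a = {Q₀(h) : h test, tsupport h ⊆ [-a, a], ∫ |h|² = 1}`  (the set of the route statement)

and `E = sInf S_a + M_a` (the bottom of the Dirichlet energy `𝓔_a` on the unit sphere of the
window) we prove:

* `markovSet_eq`, `markovSet_nonempty`, `markovSet_bddBelow`: bookkeeping of `S_a`;
* `bottom_mul_le_weilDirichletEnergy`: `E ‖h‖₂² ≤ 𝓔_a(h)` for every window test function `h`;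
* `tendsto_weilIncrement_of_tendsto`: `D_t(gₙ) → D_t(u)` along `L²`-convergent sequences;
* `finiteEnergy_of_tendsto`: **lower semicontinuity** (Fatou in the jump length): an `L²`-limit `u`
  of test functions `gₙ` with `𝓔_a(gₙ) → L` has finite archimedean energy and `𝓔_a(u) ≤ L`;
* `exists_markovMinimizer`: **existence of a minimiser**: for `a > 0` there is `u ∈ L²`,
  `∫ |u|² = 1`, `u = 0` a.e. off `[-a, a]`, of finite energy `𝓔_a(u) ≤ E` (a minimising sequence
  exists, its `Re Q` is bounded, the Connes–Consani–Moscovici compactness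
  `ConnesConsaniMoscovici2025_thm_3_6_holds` extracts an `L²`-convergent subsequence).

## References

* E. Bombieri, *Remarks on Weil's quadratic functional in the theory of prime numbers I*, Rend.
  Mat. Acc. Lincei (9) 11 (2000), §4 Thm 3 (minimising sequences converge; lower semicontinuity).
* A. Connes, C. Consani, H. Moscovici, *Zeta spectral triples*, arXiv:2511.22755, Thm 3.6.
-/

-- `Summit.RiemannHypothesis.RiemannHypothesis.…` repeats the summit name by design (D-0017 layout).
set_option linter.dupNamespace false

noncomputable section

open MeasureTheory Set Filter
open scoped Topology ENNReal NNReal ComplexConjugate ArithmeticFunction.vonMangoldt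

namespace Summit.RiemannHypothesis.RiemannHypothesis.Theorems.WeilGroundStateMarkovPart

open Literature.NumberTheory.LFunctions Literature.NumberTheory.LFunctions.ConnesVanSuijlekom
open Summit.RiemannHypothesis.RiemannHypothesis.Theorems.WeilWindowFlowWindowLipschitz

/-! ## The set of Markov form values on the unit sphere of the window -/

/-- The route statement's set of values of `Q₀ = Re Q − P` on normalised window test functions
is the set of values of `weilMarkovQuadratic`. -/
theorem markovSet_eq (a : ℝ) :
    {x : ℝ | ∃ h : ℝ → ℂ, IsWeilTest h ∧ tsupport h ⊆ Icc (-a) a ∧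
      ∫ t, ‖h t‖ ^ 2 = (1 : ℝ) ∧ x = (weilQuadratic h).re -
        2 * ‖∫ t, h t * (Real.cosh (t / 2) : ℂ)‖ ^ 2 +
        2 * ‖∫ t, h t * (Real.sinh (t / 2) : ℂ)‖ ^ 2} =
    {x : ℝ | ∃ h : ℝ → ℂ, IsWeilTest h ∧ tsupport h ⊆ Icc (-a) a ∧
      ∫ t, ‖h t‖ ^ 2 = (1 : ℝ) ∧ x = weilMarkovQuadratic h} := by
  ext x
  simp only [mem_setOf_eq, weilMarkovQuadratic_eq]

/-- On a normalised window test function, `Q₀(h) = 𝓔_a(h) − M_a`. -/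
theorem weilMarkovQuadratic_eq_energy_sub {a : ℝ} {h : ℝ → ℂ} (hh : IsWeilTest h)
    (hhs : tsupport h ⊆ Icc (-a) a) (hn : ∫ t, ‖h t‖ ^ 2 = (1 : ℝ)) :
    weilMarkovQuadratic h = weilDirichletEnergy a h - weilMarkovConstant a := by
  rw [weilMarkovQuadratic_eq_weilDirichletEnergy_sub hh hhs, hn, mul_one]

/-- The set of Markov values is non-empty for `a > 0` (the unit sphere of the window is
non-empty, `exists_isWeilTest_sphere`). -/
theorem markovSet_nonempty {a : ℝ} (ha : 0 < a) :
    {x : ℝ | ∃ h : ℝ → ℂ, IsWeilTest h ∧ tsupport h ⊆ Icc (-a) a ∧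
      ∫ t, ‖h t‖ ^ 2 = (1 : ℝ) ∧ x = weilMarkovQuadratic h}.Nonempty := by
  obtain ⟨g, hg, hsupp, hnorm⟩ := exists_isWeilTest_sphere ha
  exact ⟨_, g, hg, hsupp, hnorm, rfl⟩

/-- The set of Markov values is bounded below by `−M_a` (`𝓔_a ≥ 0`). -/
theorem markovSet_bddBelow (a : ℝ) :
    BddBelow {x : ℝ | ∃ h : ℝ → ℂ, IsWeilTest h ∧ tsupport h ⊆ Icc (-a) a ∧
      ∫ t, ‖h t‖ ^ 2 = (1 : ℝ) ∧ x = weilMarkovQuadratic h} := by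
  refine ⟨-weilMarkovConstant a, ?_⟩
  rintro x ⟨h, hh, hhs, hn, rfl⟩
  rw [weilMarkovQuadratic_eq_energy_sub hh hhs hn]
  linarith [weilDirichletEnergy_nonneg a h]

/-! ## Homogeneity and the bottom inequality on test functions -/

/-- `D_t(c h) = |c|² D_t(h)`. -/
theorem weilIncrement_const_mul (c : ℂ) (h : ℝ → ℂ) (t : ℝ) :
    weilIncrement (fun x ↦ c * h x) t = ‖c‖ ^ 2 * weilIncrement h t := by
  unfold weilIncrement
  rw [← integral_const_mul]
  refine integral_congr_ae (Eventually.of_forall fun x ↦ ?_)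
  simp only
  rw [← mul_sub, norm_mul, mul_pow]

/-- `𝓔_a(c h) = |c|² 𝓔_a(h)`. -/
theorem weilDirichletEnergy_const_mul (a : ℝ) (c : ℂ) (h : ℝ → ℂ) :
    weilDirichletEnergy a (fun x ↦ c * h x) = ‖c‖ ^ 2 * weilDirichletEnergy a h := by
  unfold weilDirichletEnergy
  simp only [weilIncrement_const_mul]
  rw [mul_add, Finset.mul_sum, ← integral_const_mul]
  congr 1
  · exact Finset.sum_congr rfl fun n _ ↦ by ring
  · exact integral_congr_ae (Eventually.of_forall fun t ↦ by ring)

/-- **The bottom inequality on window test functions.** With `E = sInf S_a + M_a`,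
`E ∫ |h|² ≤ 𝓔_a(h)` for every test function `h` supported in `[-a, a]` (normalise `h` and use
`Q₀ = 𝓔_a − M_a` on the sphere; `h = 0` when `∫ |h|² = 0`). -/
theorem bottom_mul_le_weilDirichletEnergy {a : ℝ} {h : ℝ → ℂ} (hh : IsWeilTest h)
    (hhs : tsupport h ⊆ Icc (-a) a) :
    (sInf {x : ℝ | ∃ h : ℝ → ℂ, IsWeilTest h ∧ tsupport h ⊆ Icc (-a) a ∧
      ∫ t, ‖h t‖ ^ 2 = (1 : ℝ) ∧ x = weilMarkovQuadratic h} + weilMarkovConstant a) *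
        ∫ t, ‖h t‖ ^ 2 ≤ weilDirichletEnergy a h := by
  set N : ℝ := ∫ t, ‖h t‖ ^ 2 with hN
  have hN0 : 0 ≤ N := integral_nonneg fun _ ↦ by positivity
  rcases hN0.eq_or_lt with hz | hpos
  · rw [← hz, mul_zero]
    exact weilDirichletEnergy_nonneg a h
  -- normalise
  set c : ℝ := (Real.sqrt N)⁻¹ with hc
  have hcpos : 0 < c := inv_pos.2 (Real.sqrt_pos.2 hpos)
  set h₁ : ℝ → ℂ := fun t ↦ (c : ℂ) * h t with hh₁
  have hh₁t : IsWeilTest h₁ := hh.const_mul c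
  have hh₁s : tsupport h₁ ⊆ Icc (-a) a := tsupport_mul_subset_right.trans hhs
  have hc2 : ‖(c : ℂ)‖ ^ 2 = N⁻¹ := by
    rw [Complex.norm_real, Real.norm_of_nonneg hcpos.le, hc, inv_pow, Real.sq_sqrt hN0]
  have hn₁ : ∫ t, ‖h₁ t‖ ^ 2 = 1 := by
    have : (fun t ↦ ‖h₁ t‖ ^ 2) = fun t ↦ ‖(c : ℂ)‖ ^ 2 * ‖h t‖ ^ 2 := by
      funext t; simp only [hh₁, norm_mul, mul_pow]
    rw [this, integral_const_mul, hc2, ← hN, inv_mul_cancel₀ hpos.ne']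
  have hmem : weilMarkovQuadratic h₁ ∈ {x : ℝ | ∃ h : ℝ → ℂ, IsWeilTest h ∧
      tsupport h ⊆ Icc (-a) a ∧ ∫ t, ‖h t‖ ^ 2 = (1 : ℝ) ∧ x = weilMarkovQuadratic h} :=
    ⟨h₁, hh₁t, hh₁s, hn₁, rfl⟩
  have hle := csInf_le (markovSet_bddBelow a) hmem
  rw [weilMarkovQuadratic_eq_energy_sub hh₁t hh₁s hn₁, hh₁, weilDirichletEnergy_const_mul,
    hc2] at hle
  have key : (sInf {x : ℝ | ∃ h : ℝ → ℂ, IsWeilTest h ∧ tsupport h ⊆ Icc (-a) a ∧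
      ∫ t, ‖h t‖ ^ 2 = (1 : ℝ) ∧ x = weilMarkovQuadratic h} + weilMarkovConstant a) ≤
      N⁻¹ * weilDirichletEnergy a h := by linarith
  calc _ = (sInf {x : ℝ | ∃ h : ℝ → ℂ, IsWeilTest h ∧ tsupport h ⊆ Icc (-a) a ∧
        ∫ t, ‖h t‖ ^ 2 = (1 : ℝ) ∧ x = weilMarkovQuadratic h} + weilMarkovConstant a) * N := rfl
    _ ≤ N⁻¹ * weilDirichletEnergy a h * N := mul_le_mul_of_nonneg_right key hN0
    _ = weilDirichletEnergy a h := by field_simp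

/-! ## Increments along `L²`-convergent sequences -/

/-- The increment map is `2`-Lipschitz in `L²`:
`∫ |(f(x+t) − f x) − (h(x+t) − h x)|² ≤ 4 ∫ |f − h|²`. -/
theorem integral_norm_sq_increment_sub_le {f h : ℝ → ℂ} (hf : MemLp f 2) (hh : MemLp h 2)
    (t : ℝ) :
    ∫ x, ‖(f (x + t) - f x) - (h (x + t) - h x)‖ ^ 2 ≤ 4 * ∫ x, ‖f x - h x‖ ^ 2 := by
  have hd : MemLp (fun x ↦ f x - h x) 2 := hf.sub hh
  have hdt : MemLp (fun x ↦ f (x + t) - h (x + t)) 2 :=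
    hd.comp_measurePreserving (measurePreserving_add_right volume t)
  have hM := sqrt_integral_norm_sq_sub_le hdt hd
  have htr : ∫ x, ‖f (x + t) - h (x + t)‖ ^ 2 = ∫ x, ‖f x - h x‖ ^ 2 :=
    integral_add_right_eq_self (fun x ↦ ‖f x - h x‖ ^ 2) t
  rw [htr] at hM
  have he : ∀ x, (f (x + t) - f x) - (h (x + t) - h x) = (f (x + t) - h (x + t)) - (f x - h x) :=
    fun x ↦ by ring
  simp_rw [he]
  have hA : 0 ≤ ∫ x, ‖(f (x + t) - h (x + t)) - (f x - h x)‖ ^ 2 :=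
    integral_nonneg fun _ ↦ by positivity
  have hB : 0 ≤ ∫ x, ‖f x - h x‖ ^ 2 := integral_nonneg fun _ ↦ by positivity
  calc ∫ x, ‖(f (x + t) - h (x + t)) - (f x - h x)‖ ^ 2
      = (√(∫ x, ‖(f (x + t) - h (x + t)) - (f x - h x)‖ ^ 2)) ^ 2 := (Real.sq_sqrt hA).symm
    _ ≤ (√(∫ x, ‖f x - h x‖ ^ 2) + √(∫ x, ‖f x - h x‖ ^ 2)) ^ 2 :=
        pow_le_pow_left₀ (Real.sqrt_nonneg _) hM 2
    _ = 4 * (√(∫ x, ‖f x - h x‖ ^ 2)) ^ 2 := by ring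
    _ = 4 * ∫ x, ‖f x - h x‖ ^ 2 := by rw [Real.sq_sqrt hB]

/-- **Increments converge along `L²`-convergent sequences**: `∫ |gₙ − u|² → 0` implies
`D_t(gₙ) → D_t(u)` for every `t`. -/
theorem tendsto_weilIncrement_of_tendsto {u : ℝ → ℂ} {g : ℕ → ℝ → ℂ} (hu : MemLp u 2)
    (hgm : ∀ n, MemLp (g n) 2) (hL2 : Tendsto (fun n ↦ ∫ x, ‖g n x - u x‖ ^ 2) atTop (𝓝 0))
    (t : ℝ) : Tendsto (fun n ↦ weilIncrement (g n) t) atTop (𝓝 (weilIncrement u t)) := by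
  have hU : MemLp (fun x ↦ u (x + t) - u x) 2 :=
    (hu.comp_measurePreserving (measurePreserving_add_right volume t)).sub hu
  have hG : ∀ n, MemLp (fun x ↦ g n (x + t) - g n x) 2 := fun n ↦
    ((hgm n).comp_measurePreserving (measurePreserving_add_right volume t)).sub (hgm n)
  have hlim : Tendsto (fun n ↦ ∫ x, ‖(g n (x + t) - g n x) - (u (x + t) - u x)‖ ^ 2)
      atTop (𝓝 0) := by
    refine squeeze_zero (fun n ↦ integral_nonneg fun _ ↦ by positivity)
      (fun n ↦ integral_norm_sq_increment_sub_le (hgm n) hu t) ?_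
    simpa using hL2.const_mul 4
  unfold weilIncrement
  exact tendsto_integral_norm_sq hU hG hlim

/-! ## Lower semicontinuity: Fatou in the jump length -/

/-- **Lower semicontinuity of the energy along `L²`-convergent test sequences.** If the test
functions `gₙ` converge to `u ∈ L²` in `L²` and `𝓔_a(gₙ) → L`, then `t ↦ ρ(t) D_t(u)` is
integrable on `(0, ∞)` and `𝓔_a(u) ≤ L` (the prime part converges, and Fatou's lemma in the jump
length bounds the archimedean part; Bombieri 2000, §4, proof of Thm 3). -/
theorem finiteEnergy_of_tendsto {a : ℝ} {u : ℝ → ℂ} {g : ℕ → ℝ → ℂ}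
    (hgt : ∀ n, IsWeilTest (g n)) (hu : MemLp u 2)
    (hL2 : Tendsto (fun n ↦ ∫ x, ‖g n x - u x‖ ^ 2) atTop (𝓝 0)) {L : ℝ}
    (hE : Tendsto (fun n ↦ weilDirichletEnergy a (g n)) atTop (𝓝 L)) :
    IntegrableOn (fun t ↦ weilArchDensity t * weilIncrement u t) (Ioi 0) ∧
      weilDirichletEnergy a u ≤ L := by
  have hgm : ∀ n, MemLp (g n) 2 := fun n ↦ (hgt n).memLp_two
  have hD : ∀ t, Tendsto (fun n ↦ weilIncrement (g n) t) atTop (𝓝 (weilIncrement u t)) :=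
    tendsto_weilIncrement_of_tendsto hu hgm hL2
  -- the prime parts converge
  set P : (ℝ → ℂ) → ℝ := fun f ↦ ∑ n ∈ weilPrimeIndex a,
    (Λ n : ℝ) / Real.sqrt n * weilIncrement f (Real.log n) with hP
  have hprimes : Tendsto (fun k ↦ P (g k)) atTop (𝓝 (P u)) :=
    tendsto_finsetSum _ fun n _ ↦ (hD (Real.log n)).const_mul _
  -- hence the archimedean parts converge to `L - P u`
  have hA : Tendsto (fun k ↦ ∫ t in Ioi (0 : ℝ), weilArchDensity t * weilIncrement (g k) t)
      atTop (𝓝 (L - P u)) := by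
    have e : (fun k ↦ ∫ t in Ioi (0 : ℝ), weilArchDensity t * weilIncrement (g k) t) =
        fun k ↦ weilDirichletEnergy a (g k) - P (g k) := by
      funext k
      simp only [weilDirichletEnergy, hP]
      ring
    rw [e]
    exact hE.sub hprimes
  -- Fatou
  have hFmeas : ∀ n, Measurable fun t ↦ weilArchDensity t * weilIncrement (g n) t := fun n ↦
    measurable_weilArchDensity.mul (continuous_weilIncrement (hgt n)).measurable
  have hFlim : ∀ t, Tendsto (fun n ↦ weilArchDensity t * weilIncrement (g n) t) atTop
      (𝓝 (weilArchDensity t * weilIncrement u t)) := fun t ↦ (hD t).const_mul _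
  have hFu_meas : AEStronglyMeasurable (fun t ↦ weilArchDensity t * weilIncrement u t)
      (volume.restrict (Ioi 0)) :=
    aestronglyMeasurable_of_tendsto_ae atTop (fun n ↦ (hFmeas n).aestronglyMeasurable)
      (Eventually.of_forall hFlim)
  have hF_nonneg : ∀ f : ℝ → ℂ,
      0 ≤ᵐ[volume.restrict (Ioi 0)] fun t ↦ weilArchDensity t * weilIncrement f t := fun f ↦
    (ae_restrict_iff' measurableSet_Ioi).2 (Eventually.of_forall fun t ht ↦
      mul_nonneg (weilArchDensity_pos ht).le (weilIncrement_nonneg f t))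
  have hFint : ∀ n, IntegrableOn (fun t ↦ weilArchDensity t * weilIncrement (g n) t) (Ioi 0) :=
    fun n ↦ integrableOn_weilArchDensity_mul_weilIncrement (hgt n)
  have hL : 0 ≤ L - P u := ge_of_tendsto' hA fun n ↦ setIntegral_nonneg measurableSet_Ioi
    fun t ht ↦ mul_nonneg (weilArchDensity_pos ht).le (weilIncrement_nonneg _ t)
  have hlint : ∫⁻ t in Ioi (0 : ℝ), ENNReal.ofReal (weilArchDensity t * weilIncrement u t) ≤
      ENNReal.ofReal (L - P u) := by
    have h1 : ∀ t, liminf (fun n ↦ ENNReal.ofReal (weilArchDensity t * weilIncrement (g n) t))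
        atTop = ENNReal.ofReal (weilArchDensity t * weilIncrement u t) := fun t ↦
      (ENNReal.tendsto_ofReal (hFlim t)).liminf_eq
    have h2 : Tendsto (fun n ↦ ∫⁻ t in Ioi (0 : ℝ),
        ENNReal.ofReal (weilArchDensity t * weilIncrement (g n) t)) atTop
        (𝓝 (ENNReal.ofReal (L - P u))) := by
      have h3 : ∀ n, ∫⁻ t in Ioi (0 : ℝ), ENNReal.ofReal (weilArchDensity t * weilIncrement (g n) t)
          = ENNReal.ofReal (∫ t in Ioi (0 : ℝ), weilArchDensity t * weilIncrement (g n) t) :=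
        fun n ↦ (ofReal_integral_eq_lintegral_ofReal (hFint n) (hF_nonneg (g n))).symm
      simp only [h3]
      exact ENNReal.tendsto_ofReal hA
    calc ∫⁻ t in Ioi (0 : ℝ), ENNReal.ofReal (weilArchDensity t * weilIncrement u t)
        = ∫⁻ t in Ioi (0 : ℝ), liminf (fun n ↦
            ENNReal.ofReal (weilArchDensity t * weilIncrement (g n) t)) atTop := by
          simp only [h1]
      _ ≤ liminf (fun n ↦ ∫⁻ t in Ioi (0 : ℝ),
            ENNReal.ofReal (weilArchDensity t * weilIncrement (g n) t)) atTop :=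
          lintegral_liminf_le fun n ↦ (hFmeas n).ennreal_ofReal
      _ = ENNReal.ofReal (L - P u) := h2.liminf_eq
  have hint : IntegrableOn (fun t ↦ weilArchDensity t * weilIncrement u t) (Ioi 0) :=
    ⟨hFu_meas, (hasFiniteIntegral_iff_ofReal (hF_nonneg u)).2
      (hlint.trans_lt ENNReal.ofReal_lt_top)⟩
  refine ⟨hint, ?_⟩
  have hle : ∫ t in Ioi (0 : ℝ), weilArchDensity t * weilIncrement u t ≤ L - P u := by
    rw [integral_eq_lintegral_of_nonneg_ae (hF_nonneg u) hFu_meas]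
    exact ENNReal.toReal_le_of_le_ofReal hL hlint
  have hsplit : weilDirichletEnergy a u = P u +
      ∫ t in Ioi (0 : ℝ), weilArchDensity t * weilIncrement u t := rfl
  linarith

/-! ## Existence of a minimiser -/

/-- The pole form is bounded on the unit sphere of the window: `P(h) ≤ 4a e^{2a}` for a normalised
test function `h` on `[-a, a]` (`|∫ h cosh(t/2)| ≤ e^a ‖h‖₁ ≤ e^a √(2a) ‖h‖₂`). -/
theorem weilPoleForm_le_of_sphere {a : ℝ} (ha : 0 < a) {h : ℝ → ℂ} (hh : IsWeilTest h)
    (hhs : tsupport h ⊆ Icc (-a) a) (hn : ∫ t, ‖h t‖ ^ 2 = (1 : ℝ)) :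
    weilPoleForm h ≤ 4 * a * Real.exp (2 * a) := by
  have h0 : ∀ x, x ∉ Icc (-a) a → h x = 0 := fun x hx ↦
    image_eq_zero_of_notMem_tsupport fun h' ↦ hx (hhs h')
  have hint : Integrable h := hh.1.continuous.integrable_of_hasCompactSupport hh.2
  have hcosh := stub_supBound_norm_integral_mul_le hint h0
    (k := fun x ↦ Real.cosh (x / 2)) (B := Real.exp a)
    (fun x hx ↦ (stub_supBound_cosh_sinh_le le_rfl hx).1)
  have hL1 : (∫ x, ‖h x‖) ^ 2 ≤ 2 * a * 1 := by
    have := weilNorm1_sq_le hh ha hhs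
    unfold weilNorm1 weilNorm2Sq at this
    rwa [hn] at this
  have hsq : ‖∫ x, h x * (Real.cosh (x / 2) : ℂ)‖ ^ 2 ≤ Real.exp a ^ 2 * (2 * a) := by
    calc ‖∫ x, h x * (Real.cosh (x / 2) : ℂ)‖ ^ 2 ≤ (Real.exp a * ∫ x, ‖h x‖) ^ 2 :=
          pow_le_pow_left₀ (norm_nonneg _) hcosh 2
      _ = Real.exp a ^ 2 * (∫ x, ‖h x‖) ^ 2 := by ring
      _ ≤ Real.exp a ^ 2 * (2 * a) := by
          refine mul_le_mul_of_nonneg_left ?_ (sq_nonneg _)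
          linarith
  have he : Real.exp a ^ 2 = Real.exp (2 * a) := by
    rw [sq, ← Real.exp_add]
    ring_nf
  unfold weilPoleForm
  nlinarith [hsq, he, sq_nonneg ‖∫ x, h x * (Real.sinh (x / 2) : ℂ)‖]

/-- An `L²`-limit of functions vanishing off the window vanishes a.e. off the window
(`∫_{[-a,a]ᶜ} |u|² = ∫_{[-a,a]ᶜ} |gₙ − u|² → 0`; Bombieri 2000 §4). -/
theorem ae_eq_zero_of_tendsto {a : ℝ} {u : ℝ → ℂ} {g : ℕ → ℝ → ℂ} (hu : MemLp u 2)
    (hgm : ∀ n, MemLp (g n) 2) (hg0 : ∀ n x, x ∉ Icc (-a) a → g n x = 0)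
    (hlim : Tendsto (fun n ↦ ∫ x, ‖g n x - u x‖ ^ 2) atTop (𝓝 0)) :
    ∀ᵐ x : ℝ, x ∉ Icc (-a) a → u x = 0 := by
  set S : Set ℝ := (Icc (-a) a)ᶜ with hSdef
  have hS : MeasurableSet S := measurableSet_Icc.compl
  have hint : ∀ n, Integrable (fun t ↦ ‖g n t - u t‖ ^ 2) := fun n ↦ by
    have hm : MemLp (fun t ↦ g n t - u t) 2 := (hgm n).sub hu
    exact (memLp_two_iff_integrable_sq_norm hm.1).1 hm
  have hu2 : Integrable (fun t ↦ ‖u t‖ ^ 2) := (memLp_two_iff_integrable_sq_norm hu.1).1 hu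
  have hle : ∀ n, ∫ t in S, ‖u t‖ ^ 2 ≤ ∫ t, ‖g n t - u t‖ ^ 2 := fun n ↦
    calc ∫ t in S, ‖u t‖ ^ 2 = ∫ t in S, ‖g n t - u t‖ ^ 2 := by
          refine setIntegral_congr_fun hS fun t ht ↦ ?_
          simp only [hg0 n t ht, zero_sub, norm_neg]
      _ ≤ ∫ t, ‖g n t - u t‖ ^ 2 :=
          setIntegral_le_integral (hint n) (Eventually.of_forall fun t ↦ by positivity)
  have hz : ∫ t in S, ‖u t‖ ^ 2 = 0 :=
    le_antisymm (ge_of_tendsto' hlim hle) (integral_nonneg fun t ↦ by positivity)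
  have hae : (fun t ↦ ‖u t‖ ^ 2) =ᵐ[volume.restrict S] 0 :=
    (setIntegral_eq_zero_iff_of_nonneg_ae (Eventually.of_forall fun t ↦ by positivity)
      hu2.integrableOn).1 hz
  have hae' : ∀ᵐ t ∂(volume.restrict S), u t = 0 :=
    hae.mono fun t ht ↦ by simpa using ht
  exact (ae_restrict_iff' hS).1 hae'

/-- **Existence of a minimiser of the Markov part.** For every window `a > 0` there is `u ∈ L²`
with `∫ |u|² = 1`, `u = 0` a.e. off `[-a, a]`, finite archimedean energy, and
`𝓔_a(u) ≤ sInf S_a + M_a` — the `L²`-limit of a subsequence of a normalised `Q₀`-minimising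
sequence of window test functions (minimising sequences exist as `S_a` is non-empty and bounded
below; `Re Q = Q₀ + P` stays bounded along them, so the Connes–Consani–Moscovici compactness
`ConnesConsaniMoscovici2025_thm_3_6_holds` applies; then lower semicontinuity). -/
theorem exists_markovMinimizer {a : ℝ} (ha : 0 < a) :
    ∃ u : ℝ → ℂ, MemLp u 2 ∧ (∀ᵐ x : ℝ, x ∉ Icc (-a) a → u x = 0) ∧
      ∫ x, ‖u x‖ ^ 2 = (1 : ℝ) ∧
      IntegrableOn (fun t ↦ weilArchDensity t * weilIncrement u t) (Ioi 0) ∧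
      weilDirichletEnergy a u ≤
        sInf {x : ℝ | ∃ h : ℝ → ℂ, IsWeilTest h ∧ tsupport h ⊆ Icc (-a) a ∧
          ∫ t, ‖h t‖ ^ 2 = (1 : ℝ) ∧ x = weilMarkovQuadratic h} + weilMarkovConstant a := by
  set S := {x : ℝ | ∃ h : ℝ → ℂ, IsWeilTest h ∧ tsupport h ⊆ Icc (-a) a ∧
    ∫ t, ‖h t‖ ^ 2 = (1 : ℝ) ∧ x = weilMarkovQuadratic h} with hSdef
  -- a minimising sequence
  obtain ⟨x, -, hx, hmem⟩ := exists_seq_tendsto_sInf (markovSet_nonempty ha) (markovSet_bddBelow a)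
  have hmem' : ∀ n, ∃ h : ℝ → ℂ, IsWeilTest h ∧ tsupport h ⊆ Icc (-a) a ∧
      ∫ t : ℝ, ‖h t‖ ^ 2 = 1 ∧ x n = weilMarkovQuadratic h := hmem
  choose g hg hsupp hnorm hxg using hmem'
  have hQ₀ : Tendsto (fun n ↦ weilMarkovQuadratic (g n)) atTop (𝓝 (sInf S)) := by
    have hfun : (fun n ↦ weilMarkovQuadratic (g n)) = x := funext fun n ↦ (hxg n).symm
    rw [hfun]
    exact hx
  -- `Re Q` is bounded along it
  have hbdd : BddAbove (Set.range fun n ↦ (weilQuadratic (g n)).re) := by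
    obtain ⟨B, hB⟩ := hQ₀.bddAbove_range
    refine ⟨B + 4 * a * Real.exp (2 * a), ?_⟩
    rintro _ ⟨n, rfl⟩
    simp only
    rw [weilQuadratic_re_eq_weilPoleForm_add]
    have h1 : weilMarkovQuadratic (g n) ≤ B := hB ⟨n, rfl⟩
    have h2 := weilPoleForm_le_of_sphere ha (hg n) (hsupp n) (hnorm n)
    linarith
  -- compactness
  obtain ⟨u, hu, φ, hφ, hlim⟩ := ConnesConsaniMoscovici2025_thm_3_6_holds a ha g
    (fun n ↦ ⟨hg n, hsupp n, hnorm n⟩) hbdd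
  have hgm : ∀ n, MemLp (g (φ n)) 2 := fun n ↦ (hg (φ n)).memLp_two
  refine ⟨u, hu, ?_, ?_, ?_⟩
  · exact ae_eq_zero_of_tendsto hu hgm (fun n x hx ↦
      image_eq_zero_of_notMem_tsupport fun h' ↦ hx (hsupp (φ n) h')) hlim
  · have h1 := tendsto_integral_norm_sq hu hgm hlim
    simp only [hnorm] at h1
    exact (tendsto_nhds_unique tendsto_const_nhds h1).symm
  · have hE : Tendsto (fun n ↦ weilDirichletEnergy a (g (φ n))) atTop
        (𝓝 (sInf S + weilMarkovConstant a)) := by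
      have e : (fun n ↦ weilDirichletEnergy a (g (φ n))) =
          fun n ↦ weilMarkovQuadratic (g (φ n)) + weilMarkovConstant a := by
        funext n
        rw [weilMarkovQuadratic_eq_energy_sub (hg (φ n)) (hsupp (φ n)) (hnorm (φ n))]
        ring
      rw [e]
      exact (hQ₀.comp hφ.tendsto_atTop).add tendsto_const_nhds
    exact finiteEnergy_of_tendsto (fun n ↦ hg (φ n)) hu hlim hE

end Summit.RiemannHypothesis.RiemannHypothesis.Theorems.WeilGroundStateMarkovPart

end
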